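import Summits.BirchSwinnertonDyer.BirchSwinnertonDyer.Theorems.GenusKolyvaginAtTwoOffCutResidualAtTwoRSocleSelectionHeegnerSocle
import HarnessLib

/-!
# Route `GenusKolyvaginAtTwo`, residual `OffCutResidualAtTwoR` (stmt-BirchSwinnertonDyer-31767), LINES 27/28 «socle selection» — SIGN-FREE:
# inside `H¹(ℚ, E[2])` the twin's Selmer group `Sel_𝔓(A_χ) ≅ Sel₂(Wd)` IS `{0, s_y}`, `s_y` the unique descent of `κ₂(Q₀)` (ANY sign of `Δ`, ANY Tamagawa budget)

LEAD seat `bsd-line-gk2-p1` g25 (cell `bsd-f1-sign2`), `--supports stmt-BirchSwinnertonDyer-31767 --as helper`; sequel of p776743 / p776950 (`…HeegnerSocle`,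
`…HeegnerSocleSOC`).  THEOREMS ONLY (no definition, no named fact, no `sorry`).  **BSD is NOT proved by this file; nothing is closed.**

WHY.  File 1's §3 (`resTorsion_mem_range_kummer_of_mem_primeTwist_selmerGroup`) uses NEITHER the sign of `Δ` NOR the Tamagawa budget of the twin: for
`E/ℚ` with `E(ℚ)[2] = 0`, `K ∋ √d`, ANY model `Wd = Cd • E^{(d)}` with `rank Wd(ℚ) = 1` and `#Sel₂(Wd) = 2`, every class of `T := Sel_𝔓(A_{χ_d}/ℚ)` restricts
into `κ₂(E(K))`.  With `rank E(K) = 1`, `E(K)[2] = 0` and ANY `Q₀ ∈ E(K) ∖ 2E(K)` this pins `T` down completely: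

* `mem_primeTwist_selmerGroup_iff_eq_zero_or_resTorsion_eq_kummer` — **`s ∈ T ↔ s = 0 ∨ res_K s = κ₂(Q₀)`**;
* `exists_unique_ne_zero_mem_primeTwist_selmerGroup` — `T` has exactly ONE non-zero class, and it restricts to `κ₂(Q₀)`;
* `exists_resTorsion_eq_kummer_mem_primeTwist_selmerGroup` — in particular the descent `s_y ∈ H¹(ℚ, E[2])` of `κ₂(Q₀)` EXISTS and lies in `T` (sign-free
  existence of the capitulating class; on the K₄⁺ cell gk2-p5's `KFourPosCell.existsUnique_resTorsion_eq_kummer_of_kFourPos` adds `s_y ∈ Sel₂(E)`).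
Consumers: LINE 28 N2 (Δ<0 deep prime frame `K = ℚ(√−ℓ₀)`, `ℓ₀` a transposition prime, twin budget `≤ 1`: its (SOC)/(LTV) are statements about THIS `T`, read
at the place `ℓ₀` instead of `∞`), K4Neg's prime frame (23491), and LINE 27 where file 1 §2 identifies `T` with the real-trivial line.  BSD is NOT proved by this.

References: [MazurRubin2007] §3, Prop 4.1, Def 4.3; [Kramer1981] Thm. 1; [GrossLMS1991] §5 (5.1); [SilvermanAEC2009] VIII.§2, Thm X.4.2.
-/

set_option autoImplicit false
-- the Theorems namespace of this sub repeats the summit name by design (D-0017 nested layout)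
set_option linter.dupNamespace false

noncomputable section

open scoped Classical

namespace Summit.BirchSwinnertonDyer.BirchSwinnertonDyer.Theorems.GenusExact.PlusDescent.SocleSelection

open WeierstrassCurve NumberField IsDedekindDomain Field
open Literature.NumberTheory.EllipticCurves Literature.NumberTheory.GaloisRepresentations
open Summit.BirchSwinnertonDyer.Rank1Residual.F1Sign2 (NoRationalTwoTorsion IsQuadraticCharacterOf)
open Summit.BirchSwinnertonDyer.BirchSwinnertonDyer.Theorems.GenusKolyArch
open Summit.BirchSwinnertonDyer.BirchSwinnertonDyer.Theorems.GenusSupplyNarrow.KFourPosCell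

variable (W : WeierstrassCurve ℚ) [W.IsElliptic] {K : Type} [Field K] [NumberField K]

/-- **`s ∈ Sel_𝔓(A_χ/ℚ) ↔ s = 0 ∨ res_K s = κ₂(Q₀)`** — SIGN-FREE description of the twin's Selmer group inside `H¹(ℚ, E[2])`.  Frame: `E(ℚ)[2] = 0`;
`K = ℚ(θ)` quadratic, `θ² = d`; `Wd = Cd • E^{(d)}` elliptic with `rank Wd(ℚ) = 1`, `#Sel₂(Wd) = 2`; `rank E(K) = 1`, `E(K)[2] = 0`; `Q₀ ∈ E(K) ∖ 2E(K)`;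
`χ` the character of `K`.  (→): file 1 §3 + the rank-one Kummer dichotomy + injectivity of `res_K`; (←): `#T = #Sel₂(Wd) = 2`, so `T` has a non-zero class,
which restricts to `κ₂(Q₀)` by (→), and `res_K` is injective.  BSD is NOT proved by this.
[cite: MazurRubin2007, §3, Prop 4.1, Def 4.3] [cite: Kramer1981, Thm. 1] [cite: GrossLMS1991, §5 (5.1)] -/
theorem mem_primeTwist_selmerGroup_iff_eq_zero_or_resTorsion_eq_kummer (hT : NoRationalTwoTorsion W)
    (h2 : Module.finrank ℚ K = 2) {θ : K} {d : ℤ} (hθ : θ ∉ Set.range (algebraMap ℚ K)) (hθd : θ ^ 2 = algebraMap ℚ K (d : ℚ))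
    {Wd : WeierstrassCurve ℚ} [Wd.IsElliptic] (Cd : VariableChange ℚ) (hCd : Cd • W.quadraticTwist (d : ℚ) = Wd)
    (hrank : Wd.mordellWeilRank = 1) (hSel : Nat.card (Wd.selmerGroup 2) = 2) (hrkK : (W.baseChange K).mordellWeilRank = 1)
    (h2K : ∀ T : (W.baseChange K).toAffine.Point, (2 : ℤ) • T = 0 → T = 0)
    {Q₀ : (W.baseChange K).toAffine.Point} (hQ₀ : ¬ ∃ R : (W.baseChange K).toAffine.Point, (2 : ℤ) • R = Q₀)
    {χ : absoluteGaloisGroup ℚ →ₜ* Multiplicative (ZMod 2)} (hχ : IsQuadraticCharacterOf χ d) (s : galH1Torsion W ((2 : ℕ) : ℤ)) :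
    s ∈ PrimeTwist.selmerGroup W χ ↔
      s = 0 ∨ resTorsion W K ((2 : ℕ) : ℤ) s = kummerMapTorsion (W.baseChange K) ((2 : ℕ) : ℤ) (hdiv_two_baseChange W K) Q₀ := by
  haveI : (W.baseChange K).IsElliptic := inferInstanceAs (W.map (algebraMap ℚ K)).IsElliptic
  have hd0 : d ≠ 0 := by
    rintro rfl
    apply hθ
    have h0 : θ ^ 2 = 0 := by rw [hθd]; simp
    exact ⟨0, by rw [map_zero]; exact (pow_eq_zero_iff two_ne_zero).mp h0 |>.symm⟩
  have hinj := GenusExact.EigenClassesFinite.resTorsion_injective_of_noTorsion W K h2 hθ hθd ((2 : ℕ) : ℤ) h2K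
  -- (→) for a non-zero class
  have hfwd : ∀ t ∈ PrimeTwist.selmerGroup W χ, t ≠ 0 →
      resTorsion W K ((2 : ℕ) : ℤ) t = kummerMapTorsion (W.baseChange K) ((2 : ℕ) : ℤ) (hdiv_two_baseChange W K) Q₀ := by
    intro t ht ht0
    obtain ⟨Q', hQ'⟩ := resTorsion_mem_range_kummer_of_mem_primeTwist_selmerGroup W (K := K) hT hd0 ⟨θ, hθd⟩ Cd hCd hrank hSel hχ ht
    have hne : resTorsion W K ((2 : ℕ) : ℤ) t ≠ 0 := fun h0 ↦ ht0 (hinj (by rw [h0, map_zero]))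
    rcases kummerMapTorsion_eq_zero_or_eq_of_rank_one W K hrkK h2K hQ₀ Q' with h0 | h1
    · exact absurd (hQ'.symm.trans h0) hne
    · rw [← hQ', h1]
  constructor
  · intro hs
    by_cases hs0 : s = 0
    · exact Or.inl hs0
    · exact Or.inr (hfwd s hs hs0)
  · rintro (rfl | hs)
    · exact AddSubgroup.zero_mem _
    · -- `T` has two elements: its non-zero one restricts to `κ₂(Q₀)` too, hence equals `s`
      have hcard : Nat.card (PrimeTwist.selmerGroup W χ) = 2 := by
        rw [natCard_primeTwist_selmerGroup_eq_natCard_selmerGroup_rat W hd0 hχ hCd]; exact_mod_cast hSel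
      obtain ⟨t, ht, -⟩ := (Nat.card_eq_two_iff' (⟨0, AddSubgroup.zero_mem _⟩ : PrimeTwist.selmerGroup W χ)).mp hcard
      have ht0 : (t : galH1Torsion W ((2 : ℕ) : ℤ)) ≠ 0 := fun h ↦ ht (Subtype.ext h)
      have hrt := hfwd t t.2 ht0
      have hst : s = t := hinj (by rw [hs, hrt])
      rw [hst]; exact t.2

/-- **The twin's Selmer group has exactly ONE non-zero class in `H¹(ℚ, E[2])`, and it restricts to `κ₂(Q₀)`** (same sign-free frame).  BSD is NOT proved by this.
[cite: MazurRubin2007, §3, Prop 4.1, Def 4.3] [cite: Kramer1981, Thm. 1] -/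
theorem exists_unique_ne_zero_mem_primeTwist_selmerGroup (hT : NoRationalTwoTorsion W)
    (h2 : Module.finrank ℚ K = 2) {θ : K} {d : ℤ} (hθ : θ ∉ Set.range (algebraMap ℚ K)) (hθd : θ ^ 2 = algebraMap ℚ K (d : ℚ))
    {Wd : WeierstrassCurve ℚ} [Wd.IsElliptic] (Cd : VariableChange ℚ) (hCd : Cd • W.quadraticTwist (d : ℚ) = Wd)
    (hrank : Wd.mordellWeilRank = 1) (hSel : Nat.card (Wd.selmerGroup 2) = 2) (hrkK : (W.baseChange K).mordellWeilRank = 1)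
    (h2K : ∀ T : (W.baseChange K).toAffine.Point, (2 : ℤ) • T = 0 → T = 0)
    {Q₀ : (W.baseChange K).toAffine.Point} (hQ₀ : ¬ ∃ R : (W.baseChange K).toAffine.Point, (2 : ℤ) • R = Q₀)
    {χ : absoluteGaloisGroup ℚ →ₜ* Multiplicative (ZMod 2)} (hχ : IsQuadraticCharacterOf χ d) :
    ∃! s : galH1Torsion W ((2 : ℕ) : ℤ), s ∈ PrimeTwist.selmerGroup W χ ∧ s ≠ 0 := by
  haveI : (W.baseChange K).IsElliptic := inferInstanceAs (W.map (algebraMap ℚ K)).IsElliptic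
  have hd0 : d ≠ 0 := by
    rintro rfl
    apply hθ
    have h0 : θ ^ 2 = 0 := by rw [hθd]; simp
    exact ⟨0, by rw [map_zero]; exact (pow_eq_zero_iff two_ne_zero).mp h0 |>.symm⟩
  have hinj := GenusExact.EigenClassesFinite.resTorsion_injective_of_noTorsion W K h2 hθ hθd ((2 : ℕ) : ℤ) h2K
  have hcard : Nat.card (PrimeTwist.selmerGroup W χ) = 2 := by
    rw [natCard_primeTwist_selmerGroup_eq_natCard_selmerGroup_rat W hd0 hχ hCd]; exact_mod_cast hSel
  obtain ⟨t, ht, -⟩ := (Nat.card_eq_two_iff' (⟨0, AddSubgroup.zero_mem _⟩ : PrimeTwist.selmerGroup W χ)).mp hcard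
  have ht0 : (t : galH1Torsion W ((2 : ℕ) : ℤ)) ≠ 0 := fun h ↦ ht (Subtype.ext h)
  refine ⟨t, ⟨t.2, ht0⟩, fun s ⟨hs, hs0⟩ ↦ ?_⟩
  have hrs := ((mem_primeTwist_selmerGroup_iff_eq_zero_or_resTorsion_eq_kummer W hT h2 hθ hθd Cd hCd hrank hSel hrkK h2K hQ₀ hχ s).mp
    hs).resolve_left hs0
  have hrt := ((mem_primeTwist_selmerGroup_iff_eq_zero_or_resTorsion_eq_kummer W hT h2 hθ hθd Cd hCd hrank hSel hrkK h2K hQ₀ hχ t).mp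
    t.2).resolve_left ht0
  exact hinj (by rw [hrs, hrt])

/-- **SIGN-FREE EXISTENCE OF THE CAPITULATING CLASS**: on the same frame the Kummer class `κ₂(Q₀)` DESCENDS — there is `s_y ∈ H¹(ℚ, E[2])` with
`res_K s_y = κ₂(Q₀)` — and `s_y` lies in the twin's Selmer group `Sel_𝔓(A_χ/ℚ)` (unique by injectivity of `res_K`).  BSD is NOT proved by this.
[cite: Kramer1981, Thm. 1] [cite: GrossLMS1991, §5 (5.1)] -/
theorem exists_resTorsion_eq_kummer_mem_primeTwist_selmerGroup (hT : NoRationalTwoTorsion W)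
    (h2 : Module.finrank ℚ K = 2) {θ : K} {d : ℤ} (hθ : θ ∉ Set.range (algebraMap ℚ K)) (hθd : θ ^ 2 = algebraMap ℚ K (d : ℚ))
    {Wd : WeierstrassCurve ℚ} [Wd.IsElliptic] (Cd : VariableChange ℚ) (hCd : Cd • W.quadraticTwist (d : ℚ) = Wd)
    (hrank : Wd.mordellWeilRank = 1) (hSel : Nat.card (Wd.selmerGroup 2) = 2) (hrkK : (W.baseChange K).mordellWeilRank = 1)
    (h2K : ∀ T : (W.baseChange K).toAffine.Point, (2 : ℤ) • T = 0 → T = 0)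
    {Q₀ : (W.baseChange K).toAffine.Point} (hQ₀ : ¬ ∃ R : (W.baseChange K).toAffine.Point, (2 : ℤ) • R = Q₀)
    {χ : absoluteGaloisGroup ℚ →ₜ* Multiplicative (ZMod 2)} (hχ : IsQuadraticCharacterOf χ d) :
    ∃ s : galH1Torsion W ((2 : ℕ) : ℤ), s ∈ PrimeTwist.selmerGroup W χ ∧ s ≠ 0 ∧
      resTorsion W K ((2 : ℕ) : ℤ) s = kummerMapTorsion (W.baseChange K) ((2 : ℕ) : ℤ) (hdiv_two_baseChange W K) Q₀ := by
  obtain ⟨s, ⟨hs, hs0⟩, -⟩ := exists_unique_ne_zero_mem_primeTwist_selmerGroup W hT h2 hθ hθd Cd hCd hrank hSel hrkK h2K hQ₀ hχ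
  exact ⟨s, hs, hs0, ((mem_primeTwist_selmerGroup_iff_eq_zero_or_resTorsion_eq_kummer W hT h2 hθ hθd Cd hCd hrank hSel hrkK h2K hQ₀ hχ s).mp
    hs).resolve_left hs0⟩

end Summit.BirchSwinnertonDyer.BirchSwinnertonDyer.Theorems.GenusExact.PlusDescent.SocleSelection

end
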